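import Literature.Barriers.CriticalPhenomena.PositionSpaceRGNonGibbsianSpacingSelectionProofs
import Literature.Barriers.CriticalPhenomena.PositionSpaceRGNonGibbsianHolds
import Literature.Barriers.CriticalPhenomena.PositionSpaceRGNonGibbsianThm41Step2
import HarnessLib

/-!
# Barrier `PositionSpaceRGNonGibbsian`, Theorem 4.3 line: the finite-volume estimate
# `VEFS1993_eq413_spacing` holds at spacing `b = 2`, and for `b ≥ 3` it is exactly the plus-phase
# bound (Pirogov–Sinai step) at that `(d, b)`

Companion file of `Literature/Barriers/CriticalPhenomena/PositionSpaceRGNonGibbsianSpacing.lean`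
(van Enter–Fernández–Sokal, J. Stat. Phys. **72** (1993) 879, arXiv:hep-lat/9210032), which stated
the named fact `VEFS1993_eq413_spacing`: the uniform finite-volume Griffiths–Pearce–Israel estimate
behind Theorem 4.3 (decimation with spacing `b ≥ 2`, `d ≥ 2`), i.e. Steps 1–3 of §4.3.2 in the
finite-volume form prescribed in §4.2 Step 2. The tree already proves
`VEFS1993_screening ∧ VEFS1993_plusPhase → VEFS1993_eq413_extremal ↔ VEFS1993_eq413_spacing`
(`…SpacingSelection.lean`, `…Extremal.lean`) and discharges `VEFS1993_screening`
(`…SpacingSelectionProofs.lean`), the `b = 2`, `d ≥ 3` estimate `VEFS1993_eq413`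
(`…Holds.lean`, Theorem 4.2 line) and the `d = b = 2` estimate `VEFS1993_eq413_israel`
(`…Thm41Step2.lean`, Theorem 4.1 line). Here these are assembled POINTWISE in `(d, b)`:

* `b = 2` (PROVED, `VEFS1993_eq413_spacingAt_two`): for `d ≥ 3` the body of `VEFS1993_eq413_spacing`
  at `(d, 2)` is literally `VEFS1993_eq413` (threshold `J_{c,d-1}`); for `d = 2` it is
  `VEFS1993_eq413_israel` (threshold `½ cosh⁻¹(1+√2)`, volumes `W_n`, pairs `(R, R') = (n, n+1)`),
  transported to an arbitrary core radius `R ≤ n` by the FKG monotonicity of `⟨σ_0⟩^η_W` in the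
  boundary condition (`isingExpect_fixed_mono`, Friedli–Velenik Lemma 3.23 / Exercise 3.13): every
  `η` with `T₂η ∈ 𝒩_{R,n+1,+}` dominates the extremal condition of `𝒩_{n,n+1,+}`
  (`coreAnnulusBC_le_of_mem_plusSelected_of_le`), dually for `𝒩_{·,·,-}` — §4.3.2: "The conclusions
  of Theorem 4.2 for decimation with spacing `b = 2` hold also for larger spacings", §4.3.1 Step 2:
  "`⟨σ_i⟩^{±,+,σ}_{R,R'} ≥ ⟨σ_i⟩^{±,+,-}_{R,R'}`" (4.26).
* `b ≥ 3` (`VEFS1993_eq413_spacingAt_of_plusPhaseAt`): at a fixed `(d, b)`, the plus-phase bound at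
  `(d, b)` alone — the finite-volume form of §4.3.1 Steps 2.3–2.4 with Step 3,
  "`μ^{(+)}_{∞;±}(σ_i) ≥ c > 0`", which for `b ≥ 3` is the content of §4.3.2 / App. B.5.3 ("these
  ground states satisfy the Peierls condition. It follows from P–S theory that at low temperature
  there are precisely two periodic Gibbs measures") — gives the body of `VEFS1993_eq413_spacing` at
  `(d, b)` (screening at `ε = c/2` for both parities, the spin flip for the `-` side, FKG twice).

Hence `VEFS1993_eq413_spacing_of_plusPhase_three_le`: the named fact follows from the plus-phase
bound for spacings `b ≥ 3` ONLY — the same hypothesis as `VEFS1993_thm43_of_plusPhase_three_le` of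
`…Thm43Reduction.lean` (Theorem 4.3 itself) — and from `VEFS1993_plusPhase`
(`VEFS1993_eq413_spacing_of_plusPhase`). What remains for `VEFS1993_eq413_spacing_holds` is therefore
precisely the low-temperature `+` phase of the internal-spin system with fully alternating image
spins for `b ≥ 3` (Pirogov–Sinai theory, App. B.5.3), in the finite-volume form of
`VEFS1993_plusPhase` restricted to `b ≥ 3`; nothing else.

Nothing is asserted: the file is sorry-free and introduces no named fact (D-0014, D-0026).

## References

* A. C. D. van Enter, R. Fernández, A. D. Sokal, *Regularity properties and pathologies of
  position-space renormalization-group transformations: scope and limitations of Gibbsian theory*,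
  J. Stat. Phys. 72 (1993) 879–1167, arXiv:hep-lat/9210032 — Theorems 4.1–4.3, §4.1.2 eq. (4.13),
  §4.2 Step 2, §4.3.1 Step 2 eqs. (4.26)–(4.27), §4.3.2, App. B.5.3 [VanenterFernandezSokal1993].
* S. Friedli, Y. Velenik, *Statistical Mechanics of Lattice Systems*, CUP (2017), Lemma 3.23 and
  Exercise 3.13 (monotonicity in the boundary condition) [FriedliVelenik2017].
-/

noncomputable section

namespace Literature.Barriers.CriticalPhenomena.NonGibbs

open MeasureTheory Literature.Probability.LatticeModels

variable {d : ℕ}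

/-! ### Domination of the extremal boundary conditions with a larger alternating core -/

/-- **A boundary condition selected by `𝒩_{R,R',+}` dominates the extremal condition of
`𝒩_{S,R',+}` for every intermediate core radius `R ≤ S ≤ R'`**: on the image sites of
`Λ_S ∖ Λ_R` the former is `+1 ≥ ω'_alt`, elsewhere the comparison is that of
`coreAnnulusBC_le_of_mem_plusSelected` (the configuration-level form of the first inequality of
(4.26), "`⟨σ_i⟩^{±,+,σ}_{R,R'} ≥ ⟨σ_i⟩^{±,+,-}_{R,R'}`", combined with the lowering of annulus image
spins to the alternating pattern, Step 2.3). [cite: VanenterFernandezSokal1993, §4.3.1 eq. (4.26) and Step 2.3] -/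
theorem coreAnnulusBC_le_of_mem_plusSelected_of_le {b : ℕ} (hb : 0 < b) {R S R' : ℕ}
    (hRS : R ≤ S) (hSR' : S ≤ R') {η : SpinConfig (Site d)}
    (hη : decimate d b η ∈ plusSelected d R R') :
    coreAnnulusBC d b S R' 1 (-1) ≤ η := by
  classical
  intro y
  by_cases hdiv : ∀ i, (b : ℤ) ∣ y i
  · -- `y = b · x` is an image site
    set x : Site d := fun i => y i / b with hx
    have hy : y = fun i => (b : ℤ) * x i := funext fun i => (Int.mul_ediv_cancel' (hdiv i)).symm
    rw [hy, coreAnnulusBC_apply_image hb]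
    have himg : η (fun i => (b : ℤ) * x i) = decimate d b η x := by rw [decimate_apply]
    rw [himg]
    by_cases hxS : x ∈ box d S
    · simp only [hxS, if_true]
      by_cases hxR : x ∈ box d R
      · exact (hη.1 x hxR).symm.le
      · rw [hη.2 x (box_mono d hSR' hxS) hxR]
        exact intUnits_le_one _
    · by_cases hxR' : x ∈ box d R'
      · simp only [hxS, if_false, hxR', if_true]
        have hxR : x ∉ box d R := fun h => hxS (box_mono d hRS h)
        exact (hη.2 x hxR' hxR).symm.le
      · simp only [hxS, if_false, hxR']
        exact neg_one_le_intUnits _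
  · unfold coreAnnulusBC
    simp only [hdiv, false_and, if_false]
    exact neg_one_le_intUnits _

/-- Dually, **a boundary condition selected by `𝒩_{R,R',-}` is dominated by the extremal condition
of `𝒩_{S,R',-}`** for `R ≤ S ≤ R'` (on the image sites of `Λ_S ∖ Λ_R` it is `-1 ≤ ω'_alt`); the
configuration-level form of the first inequality of (4.27).
[cite: VanenterFernandezSokal1993, §4.3.1 eq. (4.27) and Step 2.3] -/
theorem le_coreAnnulusBC_of_mem_minusSelected_of_le {b : ℕ} (hb : 0 < b) {R S R' : ℕ}
    (hRS : R ≤ S) (hSR' : S ≤ R') {η : SpinConfig (Site d)}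
    (hη : decimate d b η ∈ minusSelected d R R') :
    η ≤ coreAnnulusBC d b S R' (-1) 1 := by
  classical
  intro y
  by_cases hdiv : ∀ i, (b : ℤ) ∣ y i
  · set x : Site d := fun i => y i / b with hx
    have hy : y = fun i => (b : ℤ) * x i := funext fun i => (Int.mul_ediv_cancel' (hdiv i)).symm
    rw [hy, coreAnnulusBC_apply_image hb]
    have himg : η (fun i => (b : ℤ) * x i) = decimate d b η x := by rw [decimate_apply]
    rw [himg]
    by_cases hxS : x ∈ box d S
    · simp only [hxS, if_true]
      by_cases hxR : x ∈ box d R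
      · exact (hη.1 x hxR).le
      · rw [hη.2 x (box_mono d hSR' hxS) hxR]
        exact neg_one_le_intUnits _
    · by_cases hxR' : x ∈ box d R'
      · simp only [hxS, if_false, hxR', if_true]
        have hxR : x ∉ box d R := fun h => hxS (box_mono d hRS h)
        exact (hη.2 x hxR' hxR).le
      · simp only [hxS, if_false, hxR']
        exact intUnits_le_one _
  · unfold coreAnnulusBC
    simp only [hdiv, false_and, if_false]
    exact intUnits_le_one _

/-! ### Spacing `b = 2`: the estimate holds (Theorems 4.1 and 4.2 lines) -/

/-- **The body of `VEFS1993_eq413_spacing` at `(d, b) = (2, 2)`, for every `β > ½ cosh⁻¹(1+√2)`**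
(Theorem 4.1's threshold), from the discharged Theorem-4.1 estimate `VEFS1993_eq413_israel_holds`
(§4.1.2, (4.3)–(4.5) and (4.13): volumes `W_n = Λ^int_{2n+2} ∪ {0}`, pairs `(R, R') = (n, n+1)`,
`n ≥ n₀(β)`): given `R` take `n = max(n₀, R)`, `R' = n + 1`, `W = W_n` and the levels of
`VEFS1993_eq413_israel` at `n`; a boundary condition selected by `𝒩_{R,n+1,±}` is compared with the
extremal one of `𝒩_{n,n+1,±}` by FKG monotonicity in the boundary condition (`isingExpect_fixed_mono`,
(4.26)–(4.27) first inequalities). [cite: VanenterFernandezSokal1993, Theorem 4.1, §4.1.2 eq. (4.13) and §4.3.1 eqs. (4.26)–(4.27)] -/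
theorem VEFS1993_eq413_spacingAt_two_two {β : ℝ} (hβ : israelThreshold < β) :
    ∃ δ : ℝ, 0 < δ ∧ ∀ R : ℕ, ∃ R' : ℕ, R < R' ∧ ∃ W : Finset (Site 2), (0 : Site 2) ∈ W ∧
      (∀ x : Site 2, x ≠ 0 → (fun i => ((2 : ℕ) : ℤ) * x i) ∉ W) ∧
      ∃ cplus cminus : ℝ, δ ≤ cplus - cminus ∧
        (∀ η : SpinConfig (Site 2), decimate 2 2 η ∈ plusSelected 2 R R' →
          cplus ≤ isingExpect (zdGraph 2) W β 0 (.fixed η) (spinAt 0)) ∧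
        (∀ η : SpinConfig (Site 2), decimate 2 2 η ∈ minusSelected 2 R R' →
          isingExpect (zdGraph 2) W β 0 (.fixed η) (spinAt 0) ≤ cminus) := by
  have hβ0 : 0 ≤ β := (israelThreshold_pos.trans hβ).le
  have h2 : 0 < 2 := by norm_num
  obtain ⟨δ, hδ, n₀, hn⟩ := VEFS1993_eq413_israel_holds β hβ
  refine ⟨δ, hδ, fun R => ?_⟩
  obtain ⟨cplus, cminus, hgap, hplus, hminus⟩ := hn (max n₀ R) (le_max_left _ _)
  have hRn : R ≤ max n₀ R := le_max_right _ _
  refine ⟨max n₀ R + 1, by omega, israelVolume (max n₀ R), zero_mem_israelVolume _,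
    two_mul_not_mem_israelVolume _, cplus, cminus, hgap, fun η hη => ?_, fun η hη => ?_⟩
  · calc cplus ≤ isingExpect (zdGraph 2) (israelVolume (max n₀ R)) β 0
          (.fixed (coreAnnulusBC 2 2 (max n₀ R) (max n₀ R + 1) 1 (-1))) (spinAt 0) :=
          hplus _ (decimate_coreAnnulusBC_mem_plusSelected (d := 2) h2 _ _ (-1))
      _ ≤ isingExpect (zdGraph 2) (israelVolume (max n₀ R)) β 0 (.fixed η) (spinAt 0) :=
          isingExpect_fixed_mono (zdGraph 2) hβ0 _ 0
            (coreAnnulusBC_le_of_mem_plusSelected_of_le h2 hRn (Nat.le_succ _) hη)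
            (spinAt_mono 0) (measurable_spinAt 0)
  · calc isingExpect (zdGraph 2) (israelVolume (max n₀ R)) β 0 (.fixed η) (spinAt 0)
        ≤ isingExpect (zdGraph 2) (israelVolume (max n₀ R)) β 0
          (.fixed (coreAnnulusBC 2 2 (max n₀ R) (max n₀ R + 1) (-1) 1)) (spinAt 0) :=
          isingExpect_fixed_mono (zdGraph 2) hβ0 _ 0
            (le_coreAnnulusBC_of_mem_minusSelected_of_le h2 hRn (Nat.le_succ _) hη)
            (spinAt_mono 0) (measurable_spinAt 0)
      _ ≤ cminus := hminus _ (decimate_coreAnnulusBC_mem_minusSelected (d := 2) h2 _ _ 1)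

/-- **`VEFS1993_eq413_spacing` at spacing `b = 2` holds outright, for every `d ≥ 2`** (§4.3.2: "The
conclusions of Theorem 4.2 for decimation with spacing `b = 2` hold also for larger spacings"): for
`d ≥ 3` its body at `(d, 2)` is literally the discharged Theorem-4.2 estimate `VEFS1993_eq413_holds`
(threshold `J_{c,d-1}`), for `d = 2` it is `VEFS1993_eq413_spacingAt_two_two` (threshold
`½ cosh⁻¹(1+√2)`). [cite: VanenterFernandezSokal1993, Theorems 4.1–4.2, §4.3.1 eqs. (4.26)–(4.27) and §4.3.2] -/
theorem VEFS1993_eq413_spacingAt_two (hd : 2 ≤ d) :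
    ∃ J₀ : ℝ, ∀ β : ℝ, J₀ < β → ∃ δ : ℝ, 0 < δ ∧
      ∀ R : ℕ, ∃ R' : ℕ, R < R' ∧ ∃ W : Finset (Site d), (0 : Site d) ∈ W ∧
        (∀ x : Site d, x ≠ 0 → (fun i => ((2 : ℕ) : ℤ) * x i) ∉ W) ∧
        ∃ cplus cminus : ℝ, δ ≤ cplus - cminus ∧
          (∀ η : SpinConfig (Site d), decimate d 2 η ∈ plusSelected d R R' →
            cplus ≤ isingExpect (zdGraph d) W β 0 (.fixed η) (spinAt 0)) ∧
          (∀ η : SpinConfig (Site d), decimate d 2 η ∈ minusSelected d R R' →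
            isingExpect (zdGraph d) W β 0 (.fixed η) (spinAt 0) ≤ cminus) := by
  rcases Nat.eq_or_lt_of_le hd with h2 | h3
  · subst h2
    exact ⟨israelThreshold, fun β hβ => VEFS1993_eq413_spacingAt_two_two hβ⟩
  · exact ⟨criticalBeta (d - 1), fun β hβ => VEFS1993_eq413_holds d h3 β hβ⟩

/-! ### A fixed `(d, b)`: the estimate from the plus-phase bound at `(d, b)` -/

/-- **The body of `VEFS1993_eq413_spacing` at `(d, b)` from the plus-phase bound at `(d, b)` alone**
(`d ≥ 2`, `b ≥ 2`; the pointwise form of `VEFS1993_eq413_spacing_of_screening_plusPhase`): screening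
is discharged for every spacing (`VEFS1993_screening_holds`, §4.3.1 Steps 2.1–2.2), so given the
finite-volume plus-phase bound "`⟨σ_0⟩_{W(R')} ≥ c`, all image spins of `Λ_{R'}` alternating (either
parity), all-`+` exterior" for `β > J₂` — §4.3.1 Steps 2.3–2.4 with Step 3, for `b ≥ 3` the
Pirogov–Sinai content of §4.3.2 / App. B.5.3 — one gets, for `β > max(J₁(d,b), J₂, 0)` and every `R`:
`R' > R` beyond both screening thresholds at `ε = c/2`, `W = W(R') = Λ^int_{R'} ∪ {0}`, levels
`c₊ = ⟨σ_0⟩^{±,+,-}_{W}`, `c₋ = ⟨σ_0⟩^{±,-,+}_{W}` with `c₊ - c₋ ≥ c` (the `-` side is the spin flip of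
the other parity, "by symmetry" (4.27); the `+` annulus is lowered to the alternating pattern by
FKG, Step 2.3), and the bounds for all selected boundary conditions by FKG monotonicity in the
boundary condition ((4.26)–(4.27), first inequalities).
[cite: VanenterFernandezSokal1993, §4.3.1 Step 2 eqs. (4.26)–(4.27), §4.1.2 eq. (4.13) and §4.3.2] -/
theorem VEFS1993_eq413_spacingAt_of_plusPhaseAt {b : ℕ} (hd : 2 ≤ d) (hb : 2 ≤ b) {J₂ : ℝ}
    (hP : ∀ β : ℝ, J₂ < β → ∃ c : ℝ, 0 < c ∧ ∀ p : ℤˣ, ∀ R' : ℕ,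
      c ≤ isingExpect (zdGraph d) (spacingVolume d b R') β 0
        (.fixed (signedCoreAnnulusBC d b p R' R' 1 1)) (spinAt 0)) :
    ∃ J₀ : ℝ, ∀ β : ℝ, J₀ < β → ∃ δ : ℝ, 0 < δ ∧
      ∀ R : ℕ, ∃ R' : ℕ, R < R' ∧ ∃ W : Finset (Site d), (0 : Site d) ∈ W ∧
        (∀ x : Site d, x ≠ 0 → (fun i => (b : ℤ) * x i) ∉ W) ∧
        ∃ cplus cminus : ℝ, δ ≤ cplus - cminus ∧
          (∀ η : SpinConfig (Site d), decimate d b η ∈ plusSelected d R R' →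
            cplus ≤ isingExpect (zdGraph d) W β 0 (.fixed η) (spinAt 0)) ∧
          (∀ η : SpinConfig (Site d), decimate d b η ∈ minusSelected d R R' →
            isingExpect (zdGraph d) W β 0 (.fixed η) (spinAt 0) ≤ cminus) := by
  obtain ⟨J₁, hJ₁⟩ := VEFS1993_screening_holds d b hd hb
  refine ⟨max (max J₁ J₂) 0, fun β hβ => ?_⟩
  have hβ₁ : J₁ < β := lt_of_le_of_lt ((le_max_left _ _).trans (le_max_left _ _)) hβ
  have hβ₂ : J₂ < β := lt_of_le_of_lt ((le_max_right _ _).trans (le_max_left _ _)) hβ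
  have hβ0 : 0 ≤ β := (le_max_right _ 0).trans hβ.le
  have hb0 : 0 < b := by omega
  obtain ⟨c, hc, hcP⟩ := hP β hβ₂
  refine ⟨c, hc, fun R => ?_⟩
  obtain ⟨R₁, hR₁⟩ := hJ₁ β hβ₁ 1 R (c / 2) (half_pos hc)
  obtain ⟨R₂, hR₂⟩ := hJ₁ β hβ₁ (-1) R (c / 2) (half_pos hc)
  set R' : ℕ := max (max R₁ R₂) (R + 1) with hR'def
  have hRR' : R < R' := by omega
  have h₁ : R₁ ≤ R' := by omega
  have h₂ : R₂ ≤ R' := by omega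
  -- the `+` side, parity `p = 1`: screening at `ε = c/2`, then the annulus lowered by FKG
  have hplus : c - c / 2 ≤ isingExpect (zdGraph d) (spacingVolume d b R') β 0
      (.fixed (coreAnnulusBC d b R R' 1 (-1))) (spinAt 0) := by
    rw [← signedCoreAnnulusBC_one]
    exact sub_le_isingExpect_minusExterior hβ0 hRR'.le (hcP 1 R') (hR₁ R' h₁)
  -- the `-` side is the spin flip of the parity `p = -1` system ("by symmetry", (4.27))
  have hneg : coreAnnulusBC d b R R' (-1) 1 = -signedCoreAnnulusBC d b (-1) R R' 1 (-1) := by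
    have := neg_coreAnnulusBC (d := d) b R R' (-1) 1
    rw [neg_neg] at this
    rw [← this, neg_neg]
  have hminus : isingExpect (zdGraph d) (spacingVolume d b R') β 0
      (.fixed (coreAnnulusBC d b R R' (-1) 1)) (spinAt 0) ≤ -(c - c / 2) := by
    rw [hneg, isingExpect_spinAt_zero_fixed_neg]
    have := sub_le_isingExpect_minusExterior hβ0 hRR'.le (hcP (-1) R') (hR₂ R' h₂)
    linarith
  -- the levels are the two extremal expectations; every selected `η` is compared with them by FKG
  refine ⟨R', hRR', spacingVolume d b R', zero_mem_spacingVolume b R',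
    fun x hx => image_notMem_spacingVolume hb0 R' hx,
    isingExpect (zdGraph d) (spacingVolume d b R') β 0
      (.fixed (coreAnnulusBC d b R R' 1 (-1))) (spinAt 0),
    isingExpect (zdGraph d) (spacingVolume d b R') β 0
      (.fixed (coreAnnulusBC d b R R' (-1) 1)) (spinAt 0),
    by linarith, fun η hη => ?_, fun η hη => ?_⟩
  · exact isingExpect_fixed_mono (zdGraph d) hβ0 _ 0 (coreAnnulusBC_le_of_mem_plusSelected hb0 hη)
      (spinAt_mono 0) (measurable_spinAt 0)
  · exact isingExpect_fixed_mono (zdGraph d) hβ0 _ 0 (le_coreAnnulusBC_of_mem_minusSelected hb0 hη)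
      (spinAt_mono 0) (measurable_spinAt 0)

/-! ### The named fact from the plus phase -/

/-- **`VEFS1993_eq413_spacing` from the plus-phase bound for spacings `b ≥ 3` only** — the exact
remaining content of the named fact: the low-temperature `+` phase of the internal-spin system with
fully alternating image spins for `b ≥ 3` (§4.3.2, App. B.5.3: "for the fully alternating block-spin
configuration, the system of internal spins has only two periodic ground states … these ground states
satisfy the Peierls condition. It follows from P–S theory that at low temperature there are precisely
two periodic Gibbs measures"), in the finite-volume form of `VEFS1993_plusPhase`. Spacing `2` is
covered by the Theorem 4.1 / 4.2 estimates (`VEFS1993_eq413_spacingAt_two`). The hypothesis is the one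
of `VEFS1993_thm43_of_plusPhase_three_le` (Theorem 4.3 itself).
[cite: VanenterFernandezSokal1993, §4.3.2, App. B.5.3 and §4.3.1 Step 2] -/
theorem VEFS1993_eq413_spacing_of_plusPhase_three_le
    (hP3 : ∀ d b : ℕ, 2 ≤ d → 3 ≤ b → ∃ J₂ : ℝ, ∀ β : ℝ, J₂ < β → ∃ c : ℝ, 0 < c ∧
      ∀ p : ℤˣ, ∀ R' : ℕ, c ≤ isingExpect (zdGraph d) (spacingVolume d b R') β 0
        (.fixed (signedCoreAnnulusBC d b p R' R' 1 1)) (spinAt 0)) :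
    VEFS1993_eq413_spacing := by
  intro d b hd hb
  rcases Nat.eq_or_lt_of_le hb with h2 | h3
  · subst h2
    exact VEFS1993_eq413_spacingAt_two hd
  · obtain ⟨J₂, hJ₂⟩ := hP3 d b hd h3
    exact VEFS1993_eq413_spacingAt_of_plusPhaseAt hd hb hJ₂

/-- **`VEFS1993_eq413_spacing` from the plus phase**: with screening discharged, `VEFS1993_plusPhase`
alone implies the named fact (through the accepted glue
`VEFS1993_eq413_spacing_of_screening_plusPhase`). [cite: VanenterFernandezSokal1993, §4.3.1 Step 2 and §4.3.2] -/
theorem VEFS1993_eq413_spacing_of_plusPhase (hP : VEFS1993_plusPhase) : VEFS1993_eq413_spacing :=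
  VEFS1993_eq413_spacing_of_screening_plusPhase VEFS1993_screening_holds hP

/-- In particular, **at spacing `2` the whole chain is unconditional**: for every `d ≥ 2` there is a
threshold beyond which the estimate (4.32) for `T₂` holds for every zero-field Ising Gibbs measure
(the DLR transfer `ae_le_condExpSpinAtOrigin_of_forall_isingExpect` applied to
`VEFS1993_eq413_spacingAt_two`). [cite: VanenterFernandezSokal1993, §4.3.1 eq. (4.32) and §4.3.2] -/
theorem VEFS1993_eq432_spacingAt_two (hd : 2 ≤ d) :
    ∃ J₀ : ℝ, ∀ β : ℝ, J₀ < β → ∀ μ ∈ isingGibbsMeasures d β 0, ∃ δ : ℝ, 0 < δ ∧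
      ∀ R : ℕ, ∃ R' : ℕ, R < R' ∧ ∃ cplus cminus : ℝ, δ ≤ cplus - cminus ∧
        (∀ᵐ ω ∂(μ.map (decimate d 2)), ω ∈ plusSelected d R R' →
          cplus ≤ condExpSpinAtOrigin d (μ.map (decimate d 2)) ω) ∧
        (∀ᵐ ω ∂(μ.map (decimate d 2)), ω ∈ minusSelected d R R' →
          condExpSpinAtOrigin d (μ.map (decimate d 2)) ω ≤ cminus) := by
  obtain ⟨J₀, hJ⟩ := VEFS1993_eq413_spacingAt_two (d := d) hd
  refine ⟨J₀, fun β hβ μ hμ => ?_⟩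
  obtain ⟨δ, hδ, hR⟩ := hJ β hβ
  refine ⟨δ, hδ, fun R => ?_⟩
  obtain ⟨R', hRR', W, h0, hW, cplus, cminus, hgap, hplus, hminus⟩ := hR R
  exact ⟨R', hRR', cplus, cminus, hgap,
    ae_le_condExpSpinAtOrigin_of_forall_isingExpect (b := 2) (by norm_num) hμ h0 hW hplus,
    ae_condExpSpinAtOrigin_le_of_forall_isingExpect (b := 2) (by norm_num) hμ h0 hW hminus⟩

end Literature.Barriers.CriticalPhenomena.NonGibbs

end
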